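import Literature.NumberTheory.GaloisRepresentations.ContinuousCohomologyNineTerm
import Literature.NumberTheory.GaloisRepresentations.CyclicIndexEulerChar
import Literature.NumberTheory.GaloisRepresentations.LocalEulerPoincareCharacteristic
import Literature.NumberTheory.GaloisRepresentations.LocalGlobalCohomologyFiniteProofs
import Summits.BirchSwinnertonDyer.Rank1Residual.GaloisImage.QuotientPowCount
import HarnessLib

/-!
# The local Euler–Poincaré formula is multiplicative in short exact sequences
# (cell `b2b-bsdres`, team n1011, row T-EPC = Tate's local Euler–Poincaré characteristic; seat p04 GEN 8; stage D1)

HONEST FRAMING (cell `b2b-bsdres`, run/shared/lean/b2b/bsd-rank1-residual/, verbatim in every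
file): the goal of the cell is to DELETE the COMBINATION-SHAPED residual classes of the
Birch–Swinnerton-Dyer formula for ALL analytic-rank `≤ 1` elliptic curves over `ℚ` — "full BSD
formula for every rank `≤ 1` curve in class `C`" assembled STRICTLY from published theorems — so
that the rank-`≤ 1` remainder becomes exactly the CONSTRUCTION-SHAPED classes, which are TYPED
(missing-input `Prop`s), NOT attempted. This is not "finishing BSD". Team n1011 (N10 / N11, the
additive block X4 ∧ `p = 3`): research route; no claim beyond the stated classes; nothing is
booked; no mark / label is changed by this file. Theorems only (no definition, no named fact, no
`sorry`).  (Placement: Summits/GaloisImage with the T-EPC cone.)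

## What

Milne, *ADT* I Thm. 2.8, proof, first sentence: "both sides of the equation are additive in `M`".
For a non-archimedean local field `F` of characteristic `0` and a short exact sequence
`0 → M₁ → M₂ → M₃ → 0` of finite discrete `Γ_F`-modules with `H³(F, M₁) = 0` (e.g. `M₁` primary,
`cd Γ_F ≤ 2`): if Tate's formula `#M^{Γ}·#H²(F,M)·#(𝒪_F/(#M)) = #H¹(F,M)` holds for `M₁` and `M₃`
then it holds for `M₂` (`EPCMul.localEPC_of_isSES`) — the tree's nine-term count
`IsSES.card_nineTerm`, `#M₂ = #M₁·#M₃`, and `#(R/(ab)) = #(R/(a))·#(R/(b))` for non-zero-divisors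
(`EPCMul.natCard_quotient_span_mul`).  Stage D of the T-EPC programme uses it to reduce the fact
`localEulerPoincareCharacteristic` to modules killed by a prime.

References: J. S. Milne, *Arithmetic Duality Theorems* (2006), I §2 Thm. 2.8 [MilneADT2006];
J.-P. Serre, *Galois Cohomology* (1997), II §5.4, II §5.7 [SerreGaloisCohomology1997].
-/

noncomputable section

open CategoryTheory Function Field
open scoped ValuativeRel
open Literature.NumberTheory.GaloisRepresentations

universe u

namespace Summit.BirchSwinnertonDyer.Rank1Residual.GaloisImage

namespace EPCMul

/-! ### `#(R/(ab)) = #(R/(b))·#(R/(a))` -/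

/-- `#(R/(a·b)) = #(R/(b)) · #(R/(a))` for `a` not a zero divisor: `y ↦ a y` embeds `R/(b)` into
`R/(ab)` with cokernel `R/(a)`. [folklore] -/
theorem natCard_quotient_span_mul {R : Type*} [CommRing R] (a b : R) (ha : ∀ x : R, a * x = 0 → x = 0) :
    Nat.card (R ⧸ Ideal.span {a * b}) = Nat.card (R ⧸ Ideal.span {b}) * Nat.card (R ⧸ Ideal.span {a}) := by
  classical
  set I : Ideal R := Ideal.span {a * b} with hI
  set J : Ideal R := Ideal.span {a} with hJ
  have hIJ : I ≤ J := by
    rw [hI, Ideal.span_singleton_le_iff_mem, hJ, Ideal.mem_span_singleton]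
    exact Dvd.intro _ rfl
  let f : R ⧸ I →+ R ⧸ J := (Ideal.Quotient.factor hIJ).toAddMonoidHom
  have hf : ∀ y : R, f (Ideal.Quotient.mk I y) = Ideal.Quotient.mk J y := fun y => rfl
  have hfsurj : Surjective f := by
    intro x
    obtain ⟨y, rfl⟩ := Ideal.Quotient.mk_surjective x
    exact ⟨Ideal.Quotient.mk I y, hf y⟩
  let g : R →+ R ⧸ I := (Ideal.Quotient.mk I).toAddMonoidHom.comp (AddMonoidHom.mulLeft a)
  have hg : ∀ y : R, g y = Ideal.Quotient.mk I (a * y) := fun y => rfl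
  have hgker : g.ker = (Ideal.span {b}).toAddSubgroup := by
    ext y
    rw [AddMonoidHom.mem_ker, hg, Ideal.Quotient.eq_zero_iff_mem, Submodule.mem_toAddSubgroup, hI,
      Ideal.mem_span_singleton', Ideal.mem_span_singleton']
    constructor
    · rintro ⟨z, hz⟩
      refine ⟨z, ?_⟩
      have h0 : a * (z * b - y) = 0 := by rw [mul_sub, ← hz]; ring
      have := ha _ h0
      rwa [sub_eq_zero] at this
    · rintro ⟨z, rfl⟩
      exact ⟨z, by ring⟩
  have hgrange : g.range = f.ker := by
    ext x
    constructor
    · rintro ⟨y, rfl⟩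
      rw [AddMonoidHom.mem_ker, hg, hf, Ideal.Quotient.eq_zero_iff_mem, hJ]
      exact Ideal.mem_span_singleton'.2 ⟨y, mul_comm y a⟩
    · intro hx
      obtain ⟨y, rfl⟩ := Ideal.Quotient.mk_surjective x
      rw [AddMonoidHom.mem_ker, hf, Ideal.Quotient.eq_zero_iff_mem, hJ, Ideal.mem_span_singleton'] at hx
      obtain ⟨z, rfl⟩ := hx
      exact ⟨z, by rw [hg, mul_comm]⟩
  have h1 : Nat.card (R ⧸ I) = Nat.card ((R ⧸ I) ⧸ f.ker) * Nat.card f.ker :=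
    AddSubgroup.card_eq_card_quotient_mul_card_addSubgroup f.ker
  have h2 : Nat.card ((R ⧸ I) ⧸ f.ker) = Nat.card (R ⧸ J) :=
    Nat.card_congr (QuotientAddGroup.quotientKerEquivOfSurjective f hfsurj).toEquiv
  have h3 : Nat.card f.ker = Nat.card (R ⧸ Ideal.span {b}) := by
    rw [← hgrange, ← Nat.card_congr (QuotientAddGroup.quotientKerEquivRange g).toEquiv,
      Nat.card_congr (QuotientAddGroup.quotientAddEquivOfEq hgker).toEquiv]
    rfl
  rw [h1, h2, h3, mul_comm]

/-! ### Multiplicativity of Tate's formula -/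

variable (F : Type u) [Field F] [ValuativeRel F] [TopologicalSpace F] [IsNonarchimedeanLocalField F]
  [CharZero F]
variable {M₁ : Type u} [AddCommGroup M₁] [TopologicalSpace M₁] [DiscreteTopology M₁] [Finite M₁]
variable {M₂ : Type u} [AddCommGroup M₂] [TopologicalSpace M₂] [DiscreteTopology M₂] [Finite M₂]
variable {M₃ : Type u} [AddCommGroup M₃] [TopologicalSpace M₃] [DiscreteTopology M₃] [Finite M₃]
variable {ρ₁ : ContinuousRep (absoluteGaloisGroup F) ℤ M₁} {ρ₂ : ContinuousRep (absoluteGaloisGroup F) ℤ M₂}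
  {ρ₃ : ContinuousRep (absoluteGaloisGroup F) ℤ M₃}
variable {f : ρ₁.toTopRep ⟶ ρ₂.toTopRep} {g : ρ₂.toTopRep ⟶ ρ₃.toTopRep}

omit [ValuativeRel F] [TopologicalSpace F] [IsNonarchimedeanLocalField F] [CharZero F]
  [TopologicalSpace M₁] [DiscreteTopology M₁] [TopologicalSpace M₂] [DiscreteTopology M₂]
  [TopologicalSpace M₃] [DiscreteTopology M₃] [Finite M₁] [Finite M₂] [Finite M₃] in
/-- `#M₂ = #M₁ · #M₃` for a short exact sequence of finite abelian groups (given by additive maps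
with the `IsSES` exactness properties). [folklore] -/
theorem natCard_mid_eq (φ : M₁ →+ M₂) (ψ : M₂ →+ M₃) (hφ : Injective φ) (hψ : Surjective ψ)
    (hex : ∀ y, ψ y = 0 → ∃ x, φ x = y) (hcomp : ∀ x, ψ (φ x) = 0) :
    Nat.card M₂ = Nat.card M₁ * Nat.card M₃ := by
  have hker : ψ.ker = φ.range := by
    ext y
    rw [AddMonoidHom.mem_ker]
    constructor
    · intro hy; obtain ⟨x, rfl⟩ := hex y hy; exact ⟨x, rfl⟩
    · rintro ⟨x, rfl⟩; exact hcomp x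
  rw [AddSubgroup.card_eq_card_quotient_mul_card_addSubgroup ψ.ker,
    Nat.card_congr (QuotientAddGroup.quotientKerEquivOfSurjective ψ hψ).toEquiv, hker,
    Nat.card_congr (AddMonoidHom.ofInjective hφ).toEquiv.symm, mul_comm]

/-- **Tate's local Euler–Poincaré formula is multiplicative in short exact sequences**: for a short
exact sequence `0 → M₁ → M₂ → M₃ → 0` of finite discrete `Γ_F`-modules over a non-archimedean local
field `F` of characteristic `0` with `H³(F, M₁) = 0`, if
`#M^{Γ_F} · #H²(F, M) · #(𝒪_F / (#M)) = #H¹(F, M)` (with `H¹, H²` finite) holds for `M = M₁` and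
`M = M₃`, it holds for `M = M₂` ("both sides are additive in `M`").
[cite: MilneADT2006, I §2 Thm 2.8 (proof)] [cite: SerreGaloisCohomology1997, II §5.7] -/
theorem localEPC_of_isSES (h : IsSES f g) [Subsingleton (continuousCohomology 3 ρ₁.toTopRep)]
    (h₁ : Finite (continuousCohomology 1 ρ₁.toTopRep) ∧ Finite (continuousCohomology 2 ρ₁.toTopRep) ∧
      Nat.card ρ₁.toTopRep.ρ.invariants * Nat.card (continuousCohomology 2 ρ₁.toTopRep) *
          Nat.card (𝒪[F] ⧸ Ideal.span {((Nat.card M₁ : ℕ) : 𝒪[F])}) =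
        Nat.card (continuousCohomology 1 ρ₁.toTopRep))
    (h₃ : Finite (continuousCohomology 1 ρ₃.toTopRep) ∧ Finite (continuousCohomology 2 ρ₃.toTopRep) ∧
      Nat.card ρ₃.toTopRep.ρ.invariants * Nat.card (continuousCohomology 2 ρ₃.toTopRep) *
          Nat.card (𝒪[F] ⧸ Ideal.span {((Nat.card M₃ : ℕ) : 𝒪[F])}) =
        Nat.card (continuousCohomology 1 ρ₃.toTopRep)) :
    Finite (continuousCohomology 1 ρ₂.toTopRep) ∧ Finite (continuousCohomology 2 ρ₂.toTopRep) ∧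
      Nat.card ρ₂.toTopRep.ρ.invariants * Nat.card (continuousCohomology 2 ρ₂.toTopRep) *
          Nat.card (𝒪[F] ⧸ Ideal.span {((Nat.card M₂ : ℕ) : 𝒪[F])}) =
        Nat.card (continuousCohomology 1 ρ₂.toTopRep) := by
  classical
  haveI := absoluteGaloisGroup_compactSpace F
  obtain ⟨hf1₁, hf2₁, he₁⟩ := h₁
  obtain ⟨hf1₃, hf2₃, he₃⟩ := h₃
  haveI := hf1₁; haveI := hf2₁; haveI := hf1₃; haveI := hf2₃
  haveI hf1₂ : Finite (continuousCohomology 1 ρ₂.toTopRep) :=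
    finite_galoisCohomology_one_of_isNonarchimedeanLocalField ρ₂
  haveI hf2₂ : Finite (continuousCohomology 2 ρ₂.toTopRep) :=
    finite_of_exact (cohomologyMap f 2).hom.toLinearMap.toAddMonoidHom
      (cohomologyMap g 2).hom.toLinearMap.toAddMonoidHom
      fun y hy => h.exists_map_two_eq_of_map_two_eq_zero y hy
  refine ⟨hf1₂, hf2₂, ?_⟩
  have h9 := h.card_nineTerm
  -- `#M₂ = #M₁ #M₃` and the integer term
  have hM : Nat.card M₂ = Nat.card M₁ * Nat.card M₃ :=
    natCard_mid_eq f.hom.toLinearMap.toAddMonoidHom g.hom.toLinearMap.toAddMonoidHom h.injective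
      h.surjective h.exact_mid fun x => by
        change (f ≫ g).hom x = 0
        rw [h.comp_eq_zero]; rfl
  have hnzd : ∀ (n : ℕ), n ≠ 0 → ∀ x : 𝒪[F], (n : 𝒪[F]) * x = 0 → x = 0 := fun n hn x hx => by
    rcases mul_eq_zero.1 hx with h0 | h0
    · exact absurd h0 (Nat.cast_ne_zero.2 hn)
    · exact h0
  have hint : Nat.card (𝒪[F] ⧸ Ideal.span {((Nat.card M₂ : ℕ) : 𝒪[F])}) =
      Nat.card (𝒪[F] ⧸ Ideal.span {((Nat.card M₁ : ℕ) : 𝒪[F])}) *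
        Nat.card (𝒪[F] ⧸ Ideal.span {((Nat.card M₃ : ℕ) : 𝒪[F])}) := by
    rw [hM, Nat.cast_mul, mul_comm ((Nat.card M₁ : ℕ) : 𝒪[F]),
      natCard_quotient_span_mul _ _ (hnzd _ Nat.card_pos.ne')]
  -- positivity of the cancelled factors
  have hp₁ : 0 < Nat.card ρ₁.toTopRep.ρ.invariants := Nat.card_pos
  have hp₃ : 0 < Nat.card ρ₃.toTopRep.ρ.invariants := Nat.card_pos
  have hq₁ : 0 < Nat.card (continuousCohomology 2 ρ₁.toTopRep) := Nat.card_pos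
  have hq₃ : 0 < Nat.card (continuousCohomology 2 ρ₃.toTopRep) := Nat.card_pos
  rw [hint]
  -- pure arithmetic
  generalize Nat.card ρ₁.toTopRep.ρ.invariants = a0 at h9 he₁ hp₁
  generalize Nat.card (continuousCohomology 1 ρ₁.toTopRep) = a1 at h9 he₁
  generalize Nat.card (continuousCohomology 2 ρ₁.toTopRep) = a2 at h9 he₁ hq₁
  generalize Nat.card ρ₂.toTopRep.ρ.invariants = b0 at h9
  generalize Nat.card (continuousCohomology 1 ρ₂.toTopRep) = b1 at h9
  generalize Nat.card (continuousCohomology 2 ρ₂.toTopRep) = b2 at h9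
  generalize Nat.card ρ₃.toTopRep.ρ.invariants = c0 at h9 he₃ hp₃
  generalize Nat.card (continuousCohomology 1 ρ₃.toTopRep) = c1 at h9 he₃
  generalize Nat.card (continuousCohomology 2 ρ₃.toTopRep) = c2 at h9 he₃ hq₃
  generalize Nat.card (𝒪[F] ⧸ Ideal.span {((Nat.card M₁ : ℕ) : 𝒪[F])}) = n1 at he₁
  generalize Nat.card (𝒪[F] ⧸ Ideal.span {((Nat.card M₃ : ℕ) : 𝒪[F])}) = n3 at he₃
  subst he₁ he₃
  have hX : 0 < a0 * c0 * a2 * c2 := by positivity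
  refine Nat.eq_of_mul_eq_mul_left hX ?_
  calc a0 * c0 * a2 * c2 * (b0 * b2 * (n1 * n3))
      = b0 * (a0 * a2 * n1) * (c0 * c2 * n3) * b2 := by ring
    _ = a0 * c0 * b1 * a2 * c2 := h9.symm
    _ = a0 * c0 * a2 * c2 * b1 := by ring

end EPCMul

end Summit.BirchSwinnertonDyer.Rank1Residual.GaloisImage

end
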